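import Literature.Geometry.Lorentzian.CoordMetricVariation
import Literature.Geometry.Lorentzian.CoordMetricPair
import Mathlib.Analysis.InnerProductSpace.Trace
import HarnessLib

/-!
# The metric trace and square norm along a family of metric components: bounds and the time
# derivative of `tr_{g_t} ġ_t` (Bär–Hanke 2023, §3, (9) in coordinates)

Coordinate tensor calculus (`CoordCurvature.lean`, `CoordMetricVariation.lean`), in support of
the proof programme of `Literature.Geometry.Riemannian.BaerHankePscGluing`. For metric
components `G` (and a second field `G'`) at a point `x` of a finite-dimensional real inner
product space `E` (`n = dim E`):

* `abs_traceCLM_le_finrank_mul_norm` — `|tr A| ≤ n ‖A‖`;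
* `abs_mtrAt_le`, `abs_mtrAt_sub_mtrAt_le` — `|tr_G β| ≤ n ‖♯‖ ‖β‖` and the perturbation bound
  `|tr_G β − tr_{G'} β'| ≤ n (‖♯ − ♯'‖ ‖β‖ + ‖♯'‖ ‖β − β'‖)`;
* `abs_normSqAt_le`, `abs_normSqAt_sub_normSqAt_le` — the same for `|β|²_G = tr (♯β ♯βᵀ)`;
* `IsMetricFamilyOn.contDiffOn_tDeriv_uncurry`, `IsMetricFamilyOn.hasDerivWithinAt_tDeriv` —
  the time derivative `h = ∂_t G` of a smooth family is `C^∞` jointly and differentiable in `t`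
  (second time derivative `ḣ`);
* `IsMetricFamilyOn.hasDerivWithinAt_mtrAt` — **`∂_t tr_{G_t} β_t = tr_{G_t} β̇_t − tr (♯ h ♯ β_t)`**
  (`∂_t ♯ = −♯ h ♯`, `IsMetricFamilyOn.hasDerivWithinAt_sharpAt`; Topping 2006, §2.3.2), and
  `IsMetricFamilyOn.hasDerivWithinAt_mtrAt_tDeriv` — **`∂_t tr_{G_t} h_t = tr_{G_t} ḣ_t − |h_t|²`**,
  the identity converting the `H`-form `scal = scal_t − |K|² − H² − 2 ∂_t H` of the scalar
  curvature of a generalized cylinder (`2K = h`, `2H = tr h`) into Bär–Hanke's printed form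
  `scal = scal_t + 3|K|² − H² − tr_{g_t} g̈_t` (2023, §3, (9)).

Everything is proved; no definitions, no named facts (D-0026).

## References

* C. Bär, B. Hanke, *Boundary conditions for scalar curvature*, arXiv:2012.09127, §3, (8)–(9).
  [BarHanke2023]
* P. Topping, *Lectures on the Ricci flow*, LMS LNS 325 (2006), §2.3.2. [Topping2006]
* B. O'Neill, *Semi-Riemannian geometry* (1983), Ch. 3, pp. 60–61. [ONeill1983]
-/

noncomputable section

set_option maxSynthPendingDepth 3

open Set Filter ContinuousLinearMap Module
open scoped Topology ContDiff RealInnerProductSpace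

namespace Literature.Geometry.Lorentzian

namespace MetricCoord

/-! ### Trace bounds -/

section TraceBounds

variable {E : Type*} [NormedAddCommGroup E] [InnerProductSpace ℝ E] [FiniteDimensional ℝ E]

/-- **`|tr A| ≤ n ‖A‖`** (expand the trace in an orthonormal basis). [folklore] -/
theorem abs_traceCLM_le_finrank_mul_norm (A : E →L[ℝ] E) :
    |traceCLM E A| ≤ Module.finrank ℝ E * ‖A‖ := by
  set b := stdOrthonormalBasis ℝ E with hb
  rw [traceCLM_apply, LinearMap.trace_eq_sum_inner _ b]
  refine (Finset.abs_sum_le_sum_abs _ _).trans ?_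
  have hterm : ∀ i, |⟪b i, (A : E →ₗ[ℝ] E) (b i)⟫| ≤ ‖A‖ := fun i ↦ by
    have h1 := abs_real_inner_le_norm (b i) (A (b i))
    rw [b.orthonormal.1 i, one_mul] at h1
    have h2 : ‖A (b i)‖ ≤ ‖A‖ := by
      have h := A.le_opNorm (b i)
      rwa [b.orthonormal.1 i, mul_one] at h
    exact h1.trans h2
  calc ∑ i, |⟪b i, (A : E →ₗ[ℝ] E) (b i)⟫| ≤ ∑ _i : Fin (Module.finrank ℝ E), ‖A‖ :=
        Finset.sum_le_sum fun i _ ↦ hterm i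
    _ = Module.finrank ℝ E * ‖A‖ := by
        rw [Finset.sum_const, Finset.card_univ, Fintype.card_fin, nsmul_eq_mul]

variable (G G' : E → E →L[ℝ] E →L[ℝ] ℝ) (x : E)

/-- **`|tr_G β| ≤ n ‖♯‖ ‖β‖`.** [cite: ONeill1983, Ch. 3, pp. 60–61] -/
theorem abs_mtrAt_le (β : E →L[ℝ] E →L[ℝ] ℝ) :
    |mtrAt G x β| ≤ Module.finrank ℝ E * (‖sharpAt G x‖ * ‖β‖) := by
  rw [mtrAt_eq_traceCLM]
  refine (abs_traceCLM_le_finrank_mul_norm _).trans ?_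
  gcongr
  exact opNorm_comp_le _ _

/-- **Perturbation of the metric trace**:
`|tr_G β − tr_{G'} β'| ≤ n (‖♯ − ♯'‖ ‖β‖ + ‖♯'‖ ‖β − β'‖)`. [folklore] -/
theorem abs_mtrAt_sub_mtrAt_le (β β' : E →L[ℝ] E →L[ℝ] ℝ) :
    |mtrAt G x β - mtrAt G' x β'| ≤ Module.finrank ℝ E *
      (‖sharpAt G x - sharpAt G' x‖ * ‖β‖ + ‖sharpAt G' x‖ * ‖β - β'‖) := by
  rw [mtrAt_eq_traceCLM, mtrAt_eq_traceCLM, ← map_sub]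
  refine (abs_traceCLM_le_finrank_mul_norm _).trans ?_
  gcongr
  have heq : (sharpAt G x).comp β - (sharpAt G' x).comp β' =
      (sharpAt G x - sharpAt G' x).comp β + (sharpAt G' x).comp (β - β') := by
    rw [sub_comp, comp_sub]
    abel
  rw [heq]
  exact (norm_add_le _ _).trans (add_le_add (opNorm_comp_le _ _) (opNorm_comp_le _ _))

omit [InnerProductSpace ℝ E] [FiniteDimensional ℝ E] in
/-- `(β − β')ᵀ = βᵀ − β'ᵀ`. [folklore] -/
theorem flip_sub' {F : Type*} [NormedAddCommGroup F] [NormedSpace ℝ F] (β β' : F →L[ℝ] F →L[ℝ] ℝ) :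
    (β - β').flip = β.flip - β'.flip := by
  ext v w
  rfl

/-- **`|β|²_G ≤ n (‖♯‖ ‖β‖)²`.** [cite: ONeill1983, Ch. 3, pp. 60–61] -/
theorem abs_normSqAt_le (β : E →L[ℝ] E →L[ℝ] ℝ) :
    |normSqAt G x β| ≤ Module.finrank ℝ E * (‖sharpAt G x‖ * ‖β‖) ^ 2 := by
  rw [normSqAt_eq_traceCLM]
  refine (abs_traceCLM_le_finrank_mul_norm _).trans ?_
  gcongr
  calc ‖((sharpAt G x).comp β).comp ((sharpAt G x).comp β.flip)‖
      ≤ ‖(sharpAt G x).comp β‖ * ‖(sharpAt G x).comp β.flip‖ := opNorm_comp_le _ _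
    _ ≤ (‖sharpAt G x‖ * ‖β‖) * (‖sharpAt G x‖ * ‖β.flip‖) :=
        mul_le_mul (opNorm_comp_le _ _) (opNorm_comp_le _ _) (norm_nonneg _)
          (mul_nonneg (norm_nonneg _) (norm_nonneg _))
    _ = (‖sharpAt G x‖ * ‖β‖) ^ 2 := by rw [opNorm_flip, sq]

/-- **Perturbation of the metric square norm**: with
`d = ‖♯ − ♯'‖ ‖β‖ + ‖♯'‖ ‖β − β'‖`,
`| |β|²_G − |β'|²_{G'} | ≤ n · d · (‖♯‖ ‖β‖ + ‖♯'‖ ‖β'‖)`. [folklore] -/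
theorem abs_normSqAt_sub_normSqAt_le (β β' : E →L[ℝ] E →L[ℝ] ℝ) :
    |normSqAt G x β - normSqAt G' x β'| ≤ Module.finrank ℝ E *
      ((‖sharpAt G x - sharpAt G' x‖ * ‖β‖ + ‖sharpAt G' x‖ * ‖β - β'‖) *
        (‖sharpAt G x‖ * ‖β‖ + ‖sharpAt G' x‖ * ‖β'‖)) := by
  rw [normSqAt_eq_traceCLM, normSqAt_eq_traceCLM, ← map_sub]
  refine (abs_traceCLM_le_finrank_mul_norm _).trans ?_
  gcongr
  set X := (sharpAt G x).comp β with hX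
  set Y := (sharpAt G x).comp β.flip with hY
  set X' := (sharpAt G' x).comp β' with hX'
  set Y' := (sharpAt G' x).comp β'.flip with hY'
  set d := ‖sharpAt G x - sharpAt G' x‖ * ‖β‖ + ‖sharpAt G' x‖ * ‖β - β'‖ with hd
  have hXX' : ‖X - X'‖ ≤ d := by
    have heq : X - X' = (sharpAt G x - sharpAt G' x).comp β + (sharpAt G' x).comp (β - β') := by
      rw [hX, hX', sub_comp, comp_sub]; abel
    rw [heq]
    exact (norm_add_le _ _).trans (add_le_add (opNorm_comp_le _ _) (opNorm_comp_le _ _))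
  have hYY' : ‖Y - Y'‖ ≤ d := by
    have heq : Y - Y' = (sharpAt G x - sharpAt G' x).comp β.flip +
        (sharpAt G' x).comp (β - β').flip := by
      rw [hY, hY', flip_sub', sub_comp, comp_sub]; abel
    rw [heq]
    refine (norm_add_le _ _).trans (add_le_add ?_ ?_)
    · exact (opNorm_comp_le _ _).trans (by rw [opNorm_flip])
    · exact (opNorm_comp_le _ _).trans (by rw [opNorm_flip])
  have hY0 : ‖Y‖ ≤ ‖sharpAt G x‖ * ‖β‖ := (opNorm_comp_le _ _).trans (by rw [opNorm_flip])
  have hX'0 : ‖X'‖ ≤ ‖sharpAt G' x‖ * ‖β'‖ := opNorm_comp_le _ _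
  have heq : X.comp Y - X'.comp Y' = (X - X').comp Y + X'.comp (Y - Y') := by
    rw [sub_comp, comp_sub]; abel
  rw [heq]
  have hd0 : 0 ≤ d := by positivity
  calc ‖(X - X').comp Y + X'.comp (Y - Y')‖
      ≤ ‖X - X'‖ * ‖Y‖ + ‖X'‖ * ‖Y - Y'‖ :=
        (norm_add_le _ _).trans (add_le_add (opNorm_comp_le _ _) (opNorm_comp_le _ _))
    _ ≤ d * (‖sharpAt G x‖ * ‖β‖) + (‖sharpAt G' x‖ * ‖β'‖) * d := by
        gcongr
    _ = d * (‖sharpAt G x‖ * ‖β‖ + ‖sharpAt G' x‖ * ‖β'‖) := by ring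

end TraceBounds

/-! ### The second time derivative of a family and `∂_t tr_{G_t} β_t` -/

namespace IsMetricFamilyOn

variable {E : Type*} [NormedAddCommGroup E] [NormedSpace ℝ E]
  {G : ℝ → E → E →L[ℝ] E →L[ℝ] ℝ} {S : Set ℝ} {V : Set E} {x : E} {t : ℝ}

/-- **The time derivative `h = ∂_t G` is `C^∞` jointly in `(x, t)` on `V × S`**
(`h(x, t) = DĜ(x,t)(0, 1)` for the uncurried family `Ĝ`). [folklore] -/
theorem contDiffOn_tDeriv_uncurry (hG : IsMetricFamilyOn G S V) :
    ContDiffOn ℝ ∞ (fun p : E × ℝ ↦ tDeriv G S p.2 p.1) (V ×ˢ S) := by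
  rcases S.eq_empty_or_nonempty with hS | ⟨t₀, ht₀⟩
  · simp [hS, contDiffOn_empty]
  have hV : IsOpen V := hG.isOpen ht₀
  have hQ : UniqueDiffOn ℝ (V ×ˢ S) := UniqueDiffOn.prod hV.uniqueDiffOn hG.uniqueDiffOn
  have hD : ContDiffOn ℝ ∞ (fderivWithin ℝ (fun p : E × ℝ ↦ G p.2 p.1) (V ×ˢ S)) (V ×ˢ S) :=
    hG.contDiffOn.fderivWithin hQ (by simp)
  have hsl : ContDiffOn ℝ ∞
      (fun p : E × ℝ ↦ fderivWithin ℝ (fun p : E × ℝ ↦ G p.2 p.1) (V ×ˢ S) p ((0 : E), (1 : ℝ)))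
      (V ×ˢ S) := hD.clm_apply contDiffOn_const
  refine hsl.congr fun p hp ↦ ?_
  exact (hasDerivWithinAt_tslice (F := fun p : E × ℝ ↦ G p.2 p.1)
    (hG.contDiffOn.differentiableOn (by simp)) hp.1 hp.2).derivWithin (hG.uniqueDiffOn p.2 hp.2)

/-- **The second time derivative**: `s ↦ h_s(x)` is differentiable within `S`, with derivative
`ḣ_t(x) = tDeriv (s ↦ h_s) S t x`. [folklore] -/
theorem hasDerivWithinAt_tDeriv (hG : IsMetricFamilyOn G S V) (hx : x ∈ V) (ht : t ∈ S) :
    HasDerivWithinAt (fun s ↦ tDeriv G S s x) (tDeriv (fun s ↦ tDeriv G S s) S t x) S t := by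
  have h := hasDerivWithinAt_tslice (F := fun p : E × ℝ ↦ tDeriv G S p.2 p.1)
    ((hG.contDiffOn_tDeriv_uncurry).differentiableOn (by simp)) hx ht
  exact (h.differentiableWithinAt.hasDerivWithinAt :)

/-- The time derivative is symmetric as a bilinear map: `hᵀ = h`. [folklore] -/
theorem tDeriv_flip (hG : IsMetricFamilyOn G S V) (hx : x ∈ V) (ht : t ∈ S) :
    (tDeriv G S t x).flip = tDeriv G S t x := by
  ext v w
  rw [flip_apply]
  exact hG.tDeriv_symm hx ht w v

variable [CompleteSpace E] [FiniteDimensional ℝ E]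

/-- **`∂_t tr_{G_t} β_t = tr_{G_t} β̇_t − tr (♯ h ♯ β_t)`** for a family of forms `β_s`
differentiable within `S` at `t` (`∂_t ♯ = −♯ h ♯`, Topping 2006, §2.3.2, and the Leibniz rule).
[cite: Topping2006, §2.3.2] -/
theorem hasDerivWithinAt_mtrAt (hG : IsMetricFamilyOn G S V) (hx : x ∈ V) (ht : t ∈ S)
    {β : ℝ → E →L[ℝ] E →L[ℝ] ℝ} {β' : E →L[ℝ] E →L[ℝ] ℝ} (hβ : HasDerivWithinAt β β' S t) :
    HasDerivWithinAt (fun s ↦ mtrAt (G s) x (β s))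
      (mtrAt (G t) x β' - traceCLM E (((sharpAt (G t) x).comp (tDeriv G S t x)).comp
        ((sharpAt (G t) x).comp (β t)))) S t := by
  have hs := hG.hasDerivWithinAt_sharpAt hx ht
  have hcomp := hs.clm_comp hβ
  have htr := (traceCLM E).hasFDerivAt.comp_hasDerivWithinAt t hcomp
  have hfun : (fun s ↦ mtrAt (G s) x (β s)) = (traceCLM E) ∘ fun s ↦ (sharpAt (G s) x).comp (β s) :=
    funext fun s ↦ mtrAt_eq_traceCLM _ _ _
  rw [hfun]
  refine htr.congr_deriv ?_
  rw [mtrAt_eq_traceCLM, ← map_sub]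
  congr 1
  ext1 v
  simp only [_root_.add_apply, _root_.sub_apply, _root_.neg_apply, ContinuousLinearMap.comp_apply]
  abel

/-- **`∂_t tr_{G_t} h_t = tr_{G_t} ḣ_t − |h_t|²_{G_t}`** (`h = ∂_t G`, symmetric): the identity
turning `scal = scal_t − |K|² − H² − 2∂_t H` (`2K = h`, `2H = tr h`) into Bär–Hanke's
`scal = scal_t + 3|K|² − H² − tr_{g_t} g̈_t`. [cite: BarHanke2023, §3, (9)] -/
theorem hasDerivWithinAt_mtrAt_tDeriv (hG : IsMetricFamilyOn G S V) (hx : x ∈ V) (ht : t ∈ S) :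
    HasDerivWithinAt (fun s ↦ mtrAt (G s) x (tDeriv G S s x))
      (mtrAt (G t) x (tDeriv (fun s ↦ tDeriv G S s) S t x) - normSqAt (G t) x (tDeriv G S t x))
      S t := by
  have h := hG.hasDerivWithinAt_mtrAt hx ht (hG.hasDerivWithinAt_tDeriv hx ht)
  refine h.congr_deriv ?_
  rw [normSqAt_eq_traceCLM, hG.tDeriv_flip hx ht]

end IsMetricFamilyOn

/-- With the whole line as time set, `tDeriv` is the ordinary derivative. [folklore] -/
theorem tDeriv_univ {E : Type*} [NormedAddCommGroup E] [NormedSpace ℝ E]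
    (G : ℝ → E → E →L[ℝ] E →L[ℝ] ℝ) (t : ℝ) (x : E) :
    tDeriv G univ t x = deriv (fun s ↦ G s x) t := by
  rw [tDeriv, derivWithin_univ]

end MetricCoord

end Literature.Geometry.Lorentzian
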